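import Mathlib
import Summits.NavierStokesRegularity.NavierStokesRegularity.Theorems.EulerZoomLiouvillePowerGaugeEulerLiouvilleSmallTypeIGradient
import Literature.Analysis.FluidPDE.VorticityTransportFormulaProofs
import HarnessLib.Audit

/-!
# Crux `EulerZoomLiouville.PowerGaugeEulerLiouville`: TYPE-I CLASSICAL MEMBERS WITH SUB-UNIT VORTEX STRETCHING ARE TRIVIAL
# (stratum of `stub_nonSelfSimilarRest`; the sharp form of the ancient Chae threshold)

Route №10 `EulerZoomLiouville` (NavierStokesRegularity), crux E = stmt-NavierStokesRegularity-19832, registered residue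
`stub_nonSelfSimilarRest`.  Lineage ns-typeII-p1 (gen 8).  Sequel to `…SmallTypeIGradient` (`‖∇u(τ)‖_∞ ≤ K/(−τ)`, `K < 1` ⇒
trivial): only the STRETCHING part of the velocity gradient has to be small.

Along a particle trajectory of a classical Euler flow, `d/dτ |ω|² = 2⟪∇u ω, ω⟫` (the tree's
`IsClassicalNSSolutionOn.hasDerivWithinAt_curl_flow`).  If the quadratic form of the velocity gradient is bounded above,
`⟪∇u(τ,x) w, w⟫ ≤ (K/(−τ))‖w‖²` for all `w` — i.e. the largest eigenvalue of the strain `½(∇u + ∇uᵀ)` is at most `K/(−τ)`;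
compression, rotation and the size of `‖∇u‖` are FREE — then `(−τ)^{2K}|ω(X(τ),τ)|²` is non-increasing in `τ`, so
`|ω(τ, x)|² ≤ (−τ₀)^{2K}(−τ)^{−2K}|ω(τ₀, X⁻¹)|² ≤ 16K'²(−τ₀)^{2K−2}(−τ)^{−2K}` under a Type-I gradient bound `‖∇u(τ)‖ ≤ K'/(−τ)`
(any `K'`, needed for the trajectories and for `|ω(τ₀)| ≤ 4K'/(−τ₀)`), which tends to `0` as `τ₀ → −∞` when `K < 1`.  For an
exactly self-similar member `(−τ)⟪∇u ξ, ξ⟫ = ⟪DV ξ, ξ⟫` and CIV Prop 3.3 / Thm 3.8 give stretching EXACTLY `1` at the vorticity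
maximum / along the vorticity at a stagnation point: the threshold `K < 1` on the stretching is sharp in that class.

* `norm_curl_sq_le_of_subunitStretching` — the weighted monotonicity estimate;
* `curl_eq_zero_of_subunitStretching` — Type-I gradient (any constant) + stretching `≤ K/(−τ)`, `K < 1` (any sign) ⇒ `curl u ≡ 0`;
* `ae_eq_zero_of_gauge_of_classical_irrotational` — REUSABLE TAIL: crux hypotheses + classical + `curl u ≡ 0` ⇒ `u = 0` a.e.
  (the weak gradient is a.e. the symmetric classical one; `ae_eq_zero_of_gauge_of_irrotational`);
* **`ae_eq_zero_of_gauge_of_subunitStretching`** — MEMBER LEVEL, crux hypotheses verbatim (any `ρ > −1`).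

WHAT THIS IS NOT: not NS, not E — members whose vortex stretching reaches the self-similar rate `1/(−τ)` (all putative
self-similar ones) and the weak class are untouched. [cite: Chae2010, Thm 1.1 (proof: `∂ₜ|ω| + (v·∇)|ω| = (ξ·∇v·ξ)|ω|`, ancient
form); ConstantinIgnatovaVicol2026Putative §3.3 Prop 3.3; MajdaBertozziCUP2002 §1.6 (1.51)]
-/

noncomputable section

-- flat `Theorems/<Route><Decl>…` files of one crux share the namespace of the crux (tree convention)
set_option linter.dupNamespace false

open MeasureTheory Set Filter Topology Metric Function InnerProductSpace
open scoped RealInnerProductSpace NNReal ENNReal ContDiff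

namespace Summit.NavierStokesRegularity.NavierStokesRegularity.Theorems.PowerGaugeEulerLiouville.KelvinPhysical

open Literature.Analysis Literature.Analysis.FunctionSpaces Literature.Analysis.FluidPDE

variable {u : ℝ → EuclideanSpace ℝ (Fin 3) → EuclideanSpace ℝ (Fin 3)}
  {p : ℝ → EuclideanSpace ℝ (Fin 3) → ℝ}

/-! ### The weighted monotonicity of `|ω|²` along trajectories -/

/-- **Backward stretching estimate**: for an ancient classical Euler flow with a Type-I gradient bound `‖∇u(σ)‖ ≤ K'/(−σ)`
(any `K' ≥ 0`) and sub-`K` stretching `⟪∇u(σ, x) w, w⟫ ≤ (K/(−σ))‖w‖²` (any real `K`), and `τ₀ < τ < 0`: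
`‖ω(τ, x)‖² ≤ 16 K'² (−τ₀)^{2K−2} (−τ)^{−2K}` for every `x` (`(−σ)^{2K}|ω(X(σ),σ)|²` is non-increasing along trajectories).
[cite: Chae2010, Thm 1.1 (proof display, ancient form); MajdaBertozziCUP2002 §1.6 (1.51)] -/
theorem norm_curl_sq_le_of_subunitStretching (hcl : IsClassicalEulerSolutionOn (Iio 0) 0 u p)
    {K' : ℝ} (hK'0 : 0 ≤ K') (hK' : ∀ σ : ℝ, σ < 0 → ∀ x, ‖fderiv ℝ (u σ) x‖ ≤ K' / (-σ))
    {K : ℝ}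
    (hS : ∀ σ : ℝ, σ < 0 → ∀ x w : EuclideanSpace ℝ (Fin 3), ⟪fderiv ℝ (u σ) x w, w⟫ ≤ K / (-σ) * ‖w‖ ^ 2)
    {τ₀ τ : ℝ} (h0 : τ₀ < τ) (hτ : τ < 0) (x : EuclideanSpace ℝ (Fin 3)) :
    ‖curl (u τ) x‖ ^ 2 ≤ 16 * K' ^ 2 * (-τ₀) ^ (2 * K - 2) * (-τ) ^ (-(2 * K)) := by
  have hτ₀ : τ₀ < 0 := h0.trans hτ
  have hnτ₀ : 0 < -τ₀ := by linarith
  have hnτ : 0 < -τ := by linarith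
  -- the time-translated flow `v t = u (t + τ₀)` on `S = (−∞, −τ₀) ∋ 0`
  set v : ℝ → EuclideanSpace ℝ (Fin 3) → EuclideanSpace ℝ (Fin 3) := fun t => u (t + τ₀) with hv
  set q : ℝ → EuclideanSpace ℝ (Fin 3) → ℝ := fun t => p (t + τ₀) with hq
  set S : Set ℝ := Iio (-τ₀) with hSdef
  have hclv : IsClassicalEulerSolutionOn S 0 v q := by
    have h1 := hcl.comp_add_right τ₀
    refine h1.mono (fun t ht => ?_) (uniqueDiffOn_Iio (-τ₀))
    show t + τ₀ < 0
    rw [hSdef, mem_Iio] at ht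
    linarith
  have hSc : Convex ℝ S := convex_Iio _
  have hU : UniqueDiffOn ℝ S := uniqueDiffOn_Iio _
  have h0S : (0 : ℝ) ∈ S := by rw [hSdef, mem_Iio]; linarith
  have hSo : IsOpen S := isOpen_Iio
  have hLv : ODE.IsUniformlyLipschitzOn v S := by
    refine hclv.smooth_velocity.isUniformlyLipschitzOn_of_norm_fderiv_le fun C hC hCS => ?_
    rcases C.eq_empty_or_nonempty with rfl | hne
    · exact ⟨0, fun t ht => absurd ht (notMem_empty t)⟩
    obtain ⟨t₁, ht₁C, ht₁⟩ := hC.exists_isMaxOn hne continuous_id.continuousOn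
    have ht₁S : t₁ + τ₀ < 0 := by have := hCS ht₁C; rw [hSdef, mem_Iio] at this; linarith
    refine ⟨K' / (-(t₁ + τ₀)), fun t ht y => ?_⟩
    have htS : t + τ₀ < 0 := by have := hCS ht; rw [hSdef, mem_Iio] at this; linarith
    have hle : t ≤ t₁ := ht₁ ht
    calc ‖fderiv ℝ (v t) y‖ = ‖fderiv ℝ (u (t + τ₀)) y‖ := rfl
      _ ≤ K' / (-(t + τ₀)) := hK' _ htS y
      _ ≤ K' / (-(t₁ + τ₀)) := div_le_div_of_nonneg_left hK'0 (by linarith) (by linarith)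
  -- the time `t⋆ = τ − τ₀ ∈ S` and the Lagrangian label `a = X⁻¹(x)`
  set ts : ℝ := τ - τ₀ with htsdef
  have hts0 : 0 ≤ ts := by rw [htsdef]; linarith
  have htsS : ts ∈ S := by rw [hSdef, mem_Iio, htsdef]; linarith
  set X : ℝ → EuclideanSpace ℝ (Fin 3) → EuclideanSpace ℝ (Fin 3) := ODE.evolutionMap v 0 with hXdef
  set a : EuclideanSpace ℝ (Fin 3) := ODE.evolutionMap v ts 0 x with ha
  have hXa : X ts a = x := by
    rw [hXdef, ha, hLv.evolutionMap_trans hSc htsS h0S htsS, ODE.evolutionMap_self]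
  have hX0 : X 0 a = a := by rw [hXdef, ODE.evolutionMap_self]
  have hXu : ∀ t ∈ S, ∀ y, HasDerivWithinAt (fun s => X s y) (v t (X t y)) S t :=
    fun t ht y => hLv.hasDerivWithinAt_evolutionMap hSc h0S ht y
  -- `G t = |ω(v t)(X t a)|²` and the weight `P t = (−(t+τ₀))^{2K}`
  set G : ℝ → ℝ := fun t => ‖curl (v t) (X t a)‖ ^ 2 with hGdef
  set P : ℝ → ℝ := fun t => (-(t + τ₀)) ^ (2 * K) with hPdef
  have hG' : ∀ t ∈ S, HasDerivAt G (2 * ⟪curl (v t) (X t a), fderiv ℝ (v t) (X t a) (curl (v t) (X t a))⟫) t := by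
    intro t ht
    have h1 := (hclv.hasDerivWithinAt_curl_flow hU hXu ht a).norm_sq
    exact h1.hasDerivAt (hSo.mem_nhds ht)
  have hP' : ∀ t ∈ S, HasDerivAt P ((-1) * (2 * K) * (-(t + τ₀)) ^ (2 * K - 1)) t := by
    intro t ht
    have hpos : 0 < -(t + τ₀) := by rw [hSdef, mem_Iio] at ht; linarith
    have hb : HasDerivAt (fun s : ℝ => -(s + τ₀)) (-1) t := by
      have h1 : HasDerivAt (fun s : ℝ => -s + -τ₀) (-1) t := (hasDerivAt_neg t).add_const (-τ₀)
      have e : (fun s : ℝ => -(s + τ₀)) = fun s => -s + -τ₀ := by funext s; ring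
      rw [e]; exact h1
    exact hb.rpow_const (Or.inl hpos.ne')
  -- `F = P · G` is non-increasing on `[0, ts]`
  set F : ℝ → ℝ := fun t => P t * G t with hFdef
  have hF' : ∀ t ∈ S, HasDerivAt F
      ((-1) * (2 * K) * (-(t + τ₀)) ^ (2 * K - 1) * G t +
        P t * (2 * ⟪curl (v t) (X t a), fderiv ℝ (v t) (X t a) (curl (v t) (X t a))⟫)) t :=
    fun t ht => (hP' t ht).mul (hG' t ht)
  have hF'le : ∀ t ∈ S, (-1) * (2 * K) * (-(t + τ₀)) ^ (2 * K - 1) * G t +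
      P t * (2 * ⟪curl (v t) (X t a), fderiv ℝ (v t) (X t a) (curl (v t) (X t a))⟫) ≤ 0 := by
    intro t ht
    have hpos : 0 < -(t + τ₀) := by rw [hSdef, mem_Iio] at ht; linarith
    have htτ : t + τ₀ < 0 := by linarith
    set w := curl (v t) (X t a) with hw
    have hq : ⟪w, fderiv ℝ (v t) (X t a) w⟫ ≤ K / (-(t + τ₀)) * ‖w‖ ^ 2 := by
      rw [real_inner_comm]; exact hS (t + τ₀) htτ (X t a) w
    have hPw : P t * (2 * ⟪w, fderiv ℝ (v t) (X t a) w⟫) ≤ P t * (2 * (K / (-(t + τ₀)) * ‖w‖ ^ 2)) :=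
      mul_le_mul_of_nonneg_left (by linarith) (Real.rpow_nonneg hpos.le _)
    have hid : P t * (2 * (K / (-(t + τ₀)) * ‖w‖ ^ 2)) = (2 * K) * (-(t + τ₀)) ^ (2 * K - 1) * G t := by
      simp only [hPdef, hGdef, ← hw]
      rw [Real.rpow_sub_one hpos.ne']
      field_simp
    have hG0 : G t = ‖w‖ ^ 2 := by simp only [hGdef, hw]
    nlinarith [hPw, hid]
  have hIcc : Icc 0 ts ⊆ S := fun t ht => by
    rw [hSdef, mem_Iio]; rw [htsdef] at ht; linarith [ht.2]
  have hanti : AntitoneOn F (Icc 0 ts) := by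
    refine antitoneOn_of_hasDerivWithinAt_nonpos (convex_Icc 0 ts)
      (fun t ht => (hF' t (hIcc ht)).continuousAt.continuousWithinAt)
      (fun t ht => (hF' t (hIcc (interior_subset ht))).hasDerivWithinAt) fun t ht => hF'le t (hIcc (interior_subset ht))
  have hmono := hanti (left_mem_Icc.2 hts0) (right_mem_Icc.2 hts0) hts0
  -- unpack: `(−τ)^{2K} |ω(τ,x)|² ≤ (−τ₀)^{2K} |ω(τ₀,a)|²`
  have hFts : F ts = (-τ) ^ (2 * K) * ‖curl (u τ) x‖ ^ 2 := by
    simp only [hFdef, hPdef, hGdef, hXa]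
    rw [show -(ts + τ₀) = -τ by rw [htsdef]; ring, show v ts = u τ by simp [hv, htsdef]]
  have hv0 : v 0 = u τ₀ := by simp [hv]
  have hF0 : F 0 = (-τ₀) ^ (2 * K) * ‖curl (u τ₀) a‖ ^ 2 := by
    simp only [hFdef, hPdef, hGdef, hX0, zero_add, hv0]
  rw [hFts, hF0] at hmono
  -- `|ω(τ₀, a)| ≤ 4K'/(−τ₀)`
  have hω0 : ‖curl (u τ₀) a‖ ≤ 4 * (K' / (-τ₀)) :=
    (norm_curl_le_four_mul (u τ₀) a).trans (mul_le_mul_of_nonneg_left (hK' τ₀ hτ₀ a) (by norm_num))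
  have hω0sq : ‖curl (u τ₀) a‖ ^ 2 ≤ (4 * (K' / (-τ₀))) ^ 2 := pow_le_pow_left₀ (norm_nonneg _) hω0 2
  have hwt : 0 < (-τ) ^ (2 * K) := Real.rpow_pos_of_pos hnτ _
  have hkey : ‖curl (u τ) x‖ ^ 2 ≤ (-τ₀) ^ (2 * K) * (4 * (K' / (-τ₀))) ^ 2 / (-τ) ^ (2 * K) := by
    rw [le_div_iff₀ hwt]
    calc ‖curl (u τ) x‖ ^ 2 * (-τ) ^ (2 * K) = (-τ) ^ (2 * K) * ‖curl (u τ) x‖ ^ 2 := by ring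
      _ ≤ (-τ₀) ^ (2 * K) * ‖curl (u τ₀) a‖ ^ 2 := hmono
      _ ≤ (-τ₀) ^ (2 * K) * (4 * (K' / (-τ₀))) ^ 2 :=
          mul_le_mul_of_nonneg_left hω0sq (Real.rpow_nonneg hnτ₀.le _)
  refine hkey.trans (le_of_eq ?_)
  rw [Real.rpow_neg hnτ.le, Real.rpow_sub hnτ₀, show (2 : ℝ) = ((2 : ℕ) : ℝ) by norm_num, Real.rpow_natCast]
  field_simp
  ring

/-- **Sub-unit vortex stretching ⇒ irrotational**: Type-I gradient with any constant on `(−∞,0)` and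
`⟪∇u(σ, x) w, w⟫ ≤ (K/(−σ))‖w‖²` with `K < 1` ⇒ `curl u(τ) ≡ 0` for every `τ < 0` (let `τ₀ → −∞`).
[cite: Chae2010, Thm 1.1 (ancient, stretching form)] -/
theorem curl_eq_zero_of_subunitStretching (hcl : IsClassicalEulerSolutionOn (Iio 0) 0 u p)
    {K' : ℝ} (hK' : ∀ σ : ℝ, σ < 0 → ∀ x, ‖fderiv ℝ (u σ) x‖ ≤ K' / (-σ))
    {K : ℝ} (hK1 : K < 1)
    (hS : ∀ σ : ℝ, σ < 0 → ∀ x w : EuclideanSpace ℝ (Fin 3), ⟪fderiv ℝ (u σ) x w, w⟫ ≤ K / (-σ) * ‖w‖ ^ 2)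
    {τ : ℝ} (hτ : τ < 0) (x : EuclideanSpace ℝ (Fin 3)) : curl (u τ) x = 0 := by
  have hnτ : 0 < -τ := by linarith
  have hK'0 : 0 ≤ K' := by
    have h := hK' τ hτ x
    by_contra hneg
    push Not at hneg
    have : K' / (-τ) < 0 := div_neg_of_neg_of_pos hneg hnτ
    linarith [norm_nonneg (fderiv ℝ (u τ) x)]
  have hlim : Tendsto (fun s : ℝ => 16 * K' ^ 2 * s ^ (2 * K - 2) * (-τ) ^ (-(2 * K))) atTop (𝓝 0) := by
    have h1 : Tendsto (fun s : ℝ => s ^ (-(2 - 2 * K))) atTop (𝓝 0) := tendsto_rpow_neg_atTop (by linarith)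
    have h2 := (h1.const_mul (16 * K' ^ 2)).mul_const ((-τ) ^ (-(2 * K)))
    simp only [mul_zero, zero_mul] at h2
    refine h2.congr fun s => ?_
    rw [show -(2 - 2 * K) = 2 * K - 2 by ring]
  have hsq : ‖curl (u τ) x‖ ^ 2 ≤ 0 := by
    refine ge_of_tendsto hlim ?_
    filter_upwards [eventually_gt_atTop (-τ)] with s hs
    have h := norm_curl_sq_le_of_subunitStretching hcl hK'0 hK' hS (τ₀ := -s) (by linarith) hτ x
    rw [neg_neg] at h
    exact h
  have : ‖curl (u τ) x‖ ^ 2 = 0 := le_antisymm hsq (sq_nonneg _)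
  exact norm_eq_zero.1 (pow_eq_zero_iff two_ne_zero |>.1 this)

/-! ### Member level -/

/-- **REUSABLE TAIL: an irrotational CLASSICAL member of the power-gauged class is trivial.**  Crux hypotheses verbatim (any
`ρ > −1`) + `(u, p)` classical on the past + `curl u(τ) ≡ 0` for all `τ < 0` ⇒ `u = 0` a.e. (the weak gradient is a.e. the
classical gradient, which is symmetric, and `ae_eq_zero_of_gauge_of_irrotational`). [folklore] -/
theorem ae_eq_zero_of_gauge_of_classical_irrotational {ρ : ℝ} (hρ : -1 < ρ)
    {H : ℝ → EuclideanSpace ℝ (Fin 3) → EuclideanSpace ℝ (Fin 3) →L[ℝ] EuclideanSpace ℝ (Fin 3)}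
    {c : ℝ≥0}
    (hsw : IsSuitableWeakSolutionOn (slab (EuclideanSpace ℝ (Fin 3)) (Iio 0) isOpen_Iio) 0 0 u p)
    (hH : HasWeakSpatialGradientOn (slab (EuclideanSpace ℝ (Fin 3)) (Iio 0) isOpen_Iio) u H)
    (hgauge : ∀ a : ℝ, 0 < a →
      ENNReal.ofReal (a ^ (2 * ρ)) * cknA a (0 : ℝ × EuclideanSpace ℝ (Fin 3)) u +
          ENNReal.ofReal (a ^ ρ) * cknE a (0 : ℝ × EuclideanSpace ℝ (Fin 3)) H +
        ENNReal.ofReal (a ^ (2 * ρ)) * cknD a (0 : ℝ × EuclideanSpace ℝ (Fin 3)) p ≤ (c : ℝ≥0∞))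
    (hcl : IsClassicalEulerSolutionOn (Iio 0) 0 u p)
    (hcurl0 : ∀ τ : ℝ, τ < 0 → ∀ x, curl (u τ) x = 0) :
    uncurry u =ᵐ[volume.restrict (Iio (0 : ℝ) ×ˢ (univ : Set (EuclideanSpace ℝ (Fin 3))))] 0 := by
  have h1 := ae_hasWeakGradient_slice_of_slab hH
  have h2 : ∀ᵐ t ∂(volume.restrict (Iio (0 : ℝ))),
      (fun x => H t x) =ᵐ[volume] fun x => fderiv ℝ (u t) x := by
    filter_upwards [h1, ae_restrict_mem measurableSet_Iio] with t ht htneg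
    have hcl1 : ContDiff ℝ 1 (u t) := (hcl.contDiff_velocity htneg).of_le (by exact_mod_cast le_top)
    have hw : HasWeakGradient (u t) (fderiv ℝ (u t)) := hasWeakGradient_fderiv_of_contDiff hcl1
    have := HasWeakFDerivOn.unique_holds ht hw
    rwa [TopologicalSpace.Opens.coe_top, Measure.restrict_univ] at this
  have hμ : (volume : Measure (ℝ × EuclideanSpace ℝ (Fin 3))).restrict
      (Iio (0 : ℝ) ×ˢ (univ : Set (EuclideanSpace ℝ (Fin 3)))) =
      (volume.restrict (Iio (0 : ℝ))).prod (volume : Measure (EuclideanSpace ℝ (Fin 3))) := by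
    rw [Measure.volume_eq_prod, Measure.restrict_prod_eq_prod_univ]
  have hHm : AEStronglyMeasurable (uncurry H)
      ((volume.restrict (Iio (0 : ℝ))).prod (volume : Measure (EuclideanSpace ℝ (Fin 3)))) := by
    have := hH.locallyIntegrableOn_grad.aestronglyMeasurable
    rw [← hμ]; simpa [slab] using this
  have hGcont : ContinuousOn (uncurry fun t x => fderiv ℝ (u t) x)
      (Iio (0 : ℝ) ×ˢ (univ : Set (EuclideanSpace ℝ (Fin 3)))) :=
    (hcl.smooth_velocity.fderiv_slice isOpen_Iio.uniqueDiffOn).continuousOn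
  have hGm : AEStronglyMeasurable (uncurry fun t x => fderiv ℝ (u t) x)
      ((volume.restrict (Iio (0 : ℝ))).prod (volume : Measure (EuclideanSpace ℝ (Fin 3)))) := by
    rw [← hμ]
    exact hGcont.aestronglyMeasurable (measurableSet_Iio.prod MeasurableSet.univ)
  have hHG : uncurry H =ᵐ[(volume.restrict (Iio (0 : ℝ))).prod volume]
      uncurry fun t x => fderiv ℝ (u t) x :=
    ae_eq_prod_of_ae_ae_eq hHm hGm h2
  have hsym : ∀ᵐ z ∂(volume.restrict (Iio (0 : ℝ) ×ˢ (univ : Set (EuclideanSpace ℝ (Fin 3))))),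
      ∀ v w : EuclideanSpace ℝ (Fin 3), ⟪H z.1 z.2 v, w⟫ = ⟪H z.1 z.2 w, v⟫ := by
    rw [hμ]
    have hmem : ∀ᵐ z ∂((volume.restrict (Iio (0 : ℝ))).prod
        (volume : Measure (EuclideanSpace ℝ (Fin 3)))), z.1 < 0 := by
      rw [← hμ]
      filter_upwards [ae_restrict_mem (measurableSet_Iio.prod MeasurableSet.univ)] with z hz
      exact hz.1
    filter_upwards [hHG, hmem] with z hz hzneg v w
    have e : H z.1 z.2 = fderiv ℝ (u z.1) z.2 := hz
    rw [e]
    exact inner_fderiv_comm_of_curl_eq_zero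
      (((hcl.contDiff_velocity hzneg).differentiable (by simp)) z.2) (hcurl0 z.1 hzneg z.2) v w
  exact ae_eq_zero_of_gauge_of_irrotational hρ hsw hH hgauge hsym

/-- **TYPE-I CLASSICAL MEMBERS WITH SUB-UNIT VORTEX STRETCHING ARE TRIVIAL.**  Crux hypotheses verbatim (any `ρ > −1`) +
`(u, p)` classical on the past + Type-I gradient `‖∇u(τ, x)‖ ≤ K'/(−τ)` (any `K'`) + stretching bound
`⟪∇u(τ,x) w, w⟫ ≤ (K/(−τ))‖w‖²` with `K < 1` ⇒ `u = 0` a.e.  Only the largest eigenvalue of the strain is constrained.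
[cite: Chae2010, Thm 1.1 (ancient, stretching form); folklore (irrotational tail)] -/
theorem ae_eq_zero_of_gauge_of_subunitStretching {ρ : ℝ} (hρ : -1 < ρ)
    {H : ℝ → EuclideanSpace ℝ (Fin 3) → EuclideanSpace ℝ (Fin 3) →L[ℝ] EuclideanSpace ℝ (Fin 3)}
    {c : ℝ≥0}
    (hsw : IsSuitableWeakSolutionOn (slab (EuclideanSpace ℝ (Fin 3)) (Iio 0) isOpen_Iio) 0 0 u p)
    (hH : HasWeakSpatialGradientOn (slab (EuclideanSpace ℝ (Fin 3)) (Iio 0) isOpen_Iio) u H)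
    (hgauge : ∀ a : ℝ, 0 < a →
      ENNReal.ofReal (a ^ (2 * ρ)) * cknA a (0 : ℝ × EuclideanSpace ℝ (Fin 3)) u +
          ENNReal.ofReal (a ^ ρ) * cknE a (0 : ℝ × EuclideanSpace ℝ (Fin 3)) H +
        ENNReal.ofReal (a ^ (2 * ρ)) * cknD a (0 : ℝ × EuclideanSpace ℝ (Fin 3)) p ≤ (c : ℝ≥0∞))
    (hcl : IsClassicalEulerSolutionOn (Iio 0) 0 u p)
    {K' : ℝ} (hK' : ∀ τ : ℝ, τ < 0 → ∀ x, ‖fderiv ℝ (u τ) x‖ ≤ K' / (-τ))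
    {K : ℝ} (hK1 : K < 1)
    (hS : ∀ τ : ℝ, τ < 0 → ∀ x w : EuclideanSpace ℝ (Fin 3), ⟪fderiv ℝ (u τ) x w, w⟫ ≤ K / (-τ) * ‖w‖ ^ 2) :
    uncurry u =ᵐ[volume.restrict (Iio (0 : ℝ) ×ˢ (univ : Set (EuclideanSpace ℝ (Fin 3))))] 0 :=
  ae_eq_zero_of_gauge_of_classical_irrotational hρ hsw hH hgauge hcl
    fun _ hτ x => curl_eq_zero_of_subunitStretching hcl hK' hK1 hS hτ x

end Summit.NavierStokesRegularity.NavierStokesRegularity.Theorems.PowerGaugeEulerLiouville.KelvinPhysical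

end
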